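import Summits.CriticalPhenomena.PercolationContinuityZ3.Theorems.Transplant.PlanarSkeletonFrmFromDefs
import Summits.CriticalPhenomena.PercolationContinuityZ3.Theorems.Transplant.SkelFrmFromBParamsCorrKGLenY
import Summits.CriticalPhenomena.PercolationContinuityZ3.Theorems.Transplant.SkelFrmBParamsCorrKGLenY
import Summits.CriticalPhenomena.PercolationContinuityZ3.Theorems.Transplant.SkelFrmFromBParamsSchedA
import Summits.CriticalPhenomena.PercolationContinuityZ3.Theorems.Transplant.SkelFrmBParamsSchedA
import Summits.CriticalPhenomena.PercolationContinuityZ3.Theorems.Transplant.SkelNegBParamsReachFC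
import HarnessLib
import Summits.CriticalPhenomena.PercolationContinuityZ3.Theorems.Transplant.SkelFrmBChoiceWindow
/-!
# U-WAVE PORT (RULING D-U, lead g21 2026-08-26; WAVE-U-MANIFEST v3.0 row «SkelFrmBChoiceWindow» ↦ «SkelFrmFromBChoiceWindow») of the tree module
# `Transplant/SkelFrmBChoiceWindow` onto the carrier `PlanarSkeletonFrmFrom` (frames only, cylinders connected from width `ℓ₀` on)

ORIGINAL TITLE: N2 (frames-only node `SamePDropOfSkeletonFrm₁`, OPEN) — (ζ″) ledger, THE WINDOW SLOT AND THE START-BOX ROWS of the (C) corridor: the SMALL window slot of record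

builds on p205010 (kernel theorem, internal audit signed; external expert review pending) — nothing in this file uses p205010; NOTHING is claimed about the
OPEN node U `SamePDropOfSkeletonFrmFrom₁` (nor U_s / the end state).  Lane `prim-bschramm`, seat `prim-hp-8 gen 53 (U-wave port pen, family P-hp8; tool of record = p3-g26 port_u.py)`; helper file
(`--supports stmt-CriticalPhenomena-4575 --as helper`).  PORT RULES r1–r4 of RULING D-U: declaration order and proof texts are those of the original,
byte-identical except (i) the carrier token `PlanarSkeletonFrm ↦ PlanarSkeletonFrmFrom` (binders, `namespace`/`end` lines, qualified names of twinned
declarations), (ii) carrier-FREE declarations of the original (φ-level `Skelφ…` blocks and namespace-only arithmetic residents) are NOT re-declared —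
this file imports the original and `export`s the twin-free residents (POLICY T / treatment (m1)); residents whose statement mentions a twinned
constant are copied, (iii) every carrier-binding declaration keeps its explicit binder `(Φ : PlanarSkeletonFrmFrom G)` in its own signature (r2).  Docstrings and citations are the original's.  Manifest row idx 60 (level 10; flags verbatim|DEF-ROW); filed by the hp-8 lineage under RULING M-11 (family P-hp8).
-/

open scoped Classical

noncomputable section

namespace Summit.CriticalPhenomena.PercolationContinuityZ3.Theorems.Transplant

namespace PlanarSkeletonFrmFrom

namespace NegB

open Literature.Probability.Percolation Literature.Probability.LatticeModels SimpleGraph KNCells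
open SkelConc (Consts)
open Skelφ (shearUnit kgSL)
open TwoAxis.Para (modulus)
open Neg

/-! ## §1 The small window slot -/

/-- **The window slot of record**: `b := (30·s₀, 8·s₁)` (fine units; along generous — the along reading of the arrival box carries the shear coupling
`≈ s₀·(|v_L|/n_L)·(rows/sL) ≤ 19·s₀` — across small). [this work] -/
def BSlot.small : BSlot := fun κ _ _ _ _ _ Φ t p D g f i => (if i = 0 then 30 else 8) * (fcellsA κ Φ t p D g f).s i

section Small

variable (κ : Consts) {V : Type} [DecidableEq V] [Countable V] {G : SimpleGraph V} [G.LocallyFinite] (Φ : PlanarSkeletonFrmFrom G) (t : V) (p : unitInterval)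
  (D : Skelφ.StepI.DataNS V) (g f : ℕ)

/-- `small 0 = 30·s₀`, `small 1 = 8·s₁`. [folklore] -/
theorem small_eq (κ : Consts) {V : Type} [DecidableEq V] [Countable V] {G : SimpleGraph V} [G.LocallyFinite] (Φ : PlanarSkeletonFrmFrom G) (t : V) (p : unitInterval) (D : Skelφ.StepI.DataNS V) (g : ℕ) (f : ℕ) : BSlot.small κ Φ t p D g f 0 = 30 * (fcellsA κ Φ t p D g f).s 0 ∧ BSlot.small κ Φ t p D g f 1 = 8 * (fcellsA κ Φ t p D g f).s 1 :=
  ⟨rfl, rfl⟩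

/-- `small i ≤ 30·s i` and `s i ≤ small i`. [folklore] -/
theorem small_le_thirty (κ : Consts) {V : Type} [DecidableEq V] [Countable V] {G : SimpleGraph V} [G.LocallyFinite] (Φ : PlanarSkeletonFrmFrom G) (t : V) (p : unitInterval) (D : Skelφ.StepI.DataNS V) (g : ℕ) (f : ℕ) (i : Fin 2) : BSlot.small κ Φ t p D g f i ≤ 30 * (fcellsA κ Φ t p D g f).s i ∧ (fcellsA κ Φ t p D g f).s i ≤ BSlot.small κ Φ t p D g f i := by
  have hs := (fcellsA κ Φ t p D g f).hs i
  simp only [BSlot.small]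
  split_ifs <;> omega

/-- hp-8's `hb1`: `1 ≤ small i`. [folklore] -/
theorem small_pos (κ : Consts) {V : Type} [DecidableEq V] [Countable V] {G : SimpleGraph V} [G.LocallyFinite] (Φ : PlanarSkeletonFrmFrom G) (t : V) (p : unitInterval) (D : Skelφ.StepI.DataNS V) (g : ℕ) (f : ℕ) (i : Fin 2) : 1 ≤ BSlot.small κ Φ t p D g f i := by
  have := (fcellsA κ Φ t p D g f).hs i; have := (small_le_thirty κ Φ t p D g f i).2; omega

/-- hp-8's `hb₀`: `small i ≤ 3·r i` (`r = K·s`, `K ≥ 20`), so `bS … small = small` (`bS_eq`). [folklore] -/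
theorem small_le (κ : Consts) {V : Type} [DecidableEq V] [Countable V] {G : SimpleGraph V} [G.LocallyFinite] (Φ : PlanarSkeletonFrmFrom G) (t : V) (p : unitInterval) (D : Skelφ.StepI.DataNS V) (g : ℕ) (f : ℕ) (i : Fin 2) : BSlot.small κ Φ t p D g f i ≤ 3 * (fcellsA κ Φ t p D g f).r i := by
  refine (small_le_thirty κ Φ t p D g f i).1.trans ?_
  have hr : (((fcellsA κ Φ t p D g f).r i : ℕ) : ℤ) = (fcellsA κ Φ t p D g f).K * (fcellsA κ Φ t p D g f).s i := PCells2.r_eq _ i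
  have hK := (fcellsA κ Φ t p D g f).hK
  have : ((30 * (fcellsA κ Φ t p D g f).s i : ℕ) : ℤ) ≤ ((3 * (fcellsA κ Φ t p D g f).r i : ℕ) : ℤ) := by
    push_cast; rw [hr]
    have hK' : (20 : ℤ) ≤ (fcellsA κ Φ t p D g f).K := by exact_mod_cast hK
    have hs : (0 : ℤ) ≤ (fcellsA κ Φ t p D g f).s i := by positivity
    nlinarith
  exact_mod_cast this

end Small

/-! ## §2 The start-box half-widths at `prFA` for any window `b`, and the three rows -/

section StartBox

variable (κ : Consts) {V : Type} [DecidableEq V] [Countable V] {G : SimpleGraph V} [G.LocallyFinite] (Φ : PlanarSkeletonFrmFrom G) (t : V) (p : unitInterval)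
  (D : Skelφ.StepI.DataNS V) (g f : ℕ) (b : Fin 2 → ℕ)

/-- **The start box's α-half-width** `aW := ⌈D·(c₁·n·(b₀+1) + c₀·|vα|·(b₁+1)) / (c₀·c₁·A·m)⌉` (as floor + 1) at `prFA`. [this work] -/
def aWS (κ : Consts) {V : Type} [DecidableEq V] [Countable V] {G : SimpleGraph V} [G.LocallyFinite] (Φ : PlanarSkeletonFrmFrom G) (t : V) (p : unitInterval) (D : Skelφ.StepI.DataNS V) (g : ℕ) (f : ℕ) (b : Fin 2 → ℕ) : ℤ :=
  (prFA κ Φ t p D g f).D * ((prFA κ Φ t p D g f).c₁ * (prFA κ Φ t p D g f).n * ((b 0 : ℤ) + 1) +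
      (prFA κ Φ t p D g f).c₀ * |(prFA κ Φ t p D g f).vα| * ((b 1 : ℤ) + 1)) /
    ((prFA κ Φ t p D g f).c₀ * (prFA κ Φ t p D g f).c₁ * (prFA κ Φ t p D g f).A *
      modulus (prFA κ Φ t p D g f).n (prFA κ Φ t p D g f).h (prFA κ Φ t p D g f).vα (prFA κ Φ t p D g f).vβ) + 1

/-- **The β′-extent of the box** `Bx := ⌈D·(b₁+1) / (c₁·A)⌉` at `prFA`. [this work] -/
def BxS (κ : Consts) {V : Type} [DecidableEq V] [Countable V] {G : SimpleGraph V} [G.LocallyFinite] (Φ : PlanarSkeletonFrmFrom G) (t : V) (p : unitInterval) (D : Skelφ.StepI.DataNS V) (g : ℕ) (f : ℕ) (b : Fin 2 → ℕ) : ℤ := (prFA κ Φ t p D g f).D * ((b 1 : ℤ) + 1) / ((prFA κ Φ t p D g f).c₁ * (prFA κ Φ t p D g f).A) + 1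

/-- **The start box's half-width in rows** `bL := Bx / U + 1`. [this work] -/
def bLS (κ : Consts) {V : Type} [DecidableEq V] [Countable V] {G : SimpleGraph V} [G.LocallyFinite] (Φ : PlanarSkeletonFrmFrom G) (t : V) (p : unitInterval) (D : Skelφ.StepI.DataNS V) (g : ℕ) (f : ℕ) (b : Fin 2 → ℕ) : ℤ := BxS κ Φ t p D g f b / (shearUnit (nL κ Φ t p D g f) (hL κ Φ t p D g f) : ℤ) + 1

/-- **The identities of `prFA`**: `A = Aof κ > 0`, `D = A²·m`, `c₀ = A·s₀`, `c₁ = A·s₁`, `0 < m`, `n = n_L`, `vα = v_L` (under `EqNumL`). [folklore] -/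
theorem prFA_ids (κ : Consts) {V : Type} [DecidableEq V] [Countable V] {G : SimpleGraph V} [G.LocallyFinite] (Φ : PlanarSkeletonFrmFrom G) (t : V) (p : unitInterval) (D : Skelφ.StepI.DataNS V) (g : ℕ) (f : ℕ) (hN : EqNumL κ Φ t p D g f) :
    (prFA κ Φ t p D g f).A = Aof κ ∧ 0 < Aof κ ∧
    (prFA κ Φ t p D g f).D = Aof κ ^ 2 * modulus (prFA κ Φ t p D g f).n (prFA κ Φ t p D g f).h (prFA κ Φ t p D g f).vα (prFA κ Φ t p D g f).vβ ∧
    (prFA κ Φ t p D g f).c₀ = Aof κ * (((fcellsA κ Φ t p D g f).s 0 : ℕ) : ℤ) ∧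
    (prFA κ Φ t p D g f).c₁ = Aof κ * (((fcellsA κ Φ t p D g f).s 1 : ℕ) : ℤ) ∧
    0 < modulus (prFA κ Φ t p D g f).n (prFA κ Φ t p D g f).h (prFA κ Φ t p D g f).vα (prFA κ Φ t p D g f).vβ ∧
    (prFA κ Φ t p D g f).n = nL κ Φ t p D g f ∧ (prFA κ Φ t p D g f).vα = vL κ Φ t p D g f := by
  obtain ⟨hn1, hℓ1⟩ := one_le_of_eqNumL κ Φ t p D g f hN
  have hK : ((fcellsA κ Φ t p D g f).K : ℤ) = Neg.K κ := by exact_mod_cast (fcellsA_K κ Φ t p D g f).1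
  refine ⟨rfl, (Aof_pos κ).1, ?_, ?_, ?_, ?_, rfl, rfl⟩
  · exact Skelφ.NegPrm.DofA_eq _ _ _ _ _
  · show 20 * ((fcellsA κ Φ t p D g f).K : ℤ) * (((fcellsA κ Φ t p D g f).s 0 : ℕ) : ℤ) = _
    rw [hK, Aof_eq_K]
  · show 20 * ((fcellsA κ Φ t p D g f).K : ℤ) * (((fcellsA κ Φ t p D g f).s 1 : ℕ) : ℤ) = _
    rw [hK, Aof_eq_K]
  · exact Skelφ.NegPrm.modulus_vβOf_pos hn1 hℓ1 _ _

/-- **`ha`** of `runX_mem_Icc_of_fine` at `K := b`, `aW := aWS b`. [folklore] -/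
theorem ha_S (κ : Consts) {V : Type} [DecidableEq V] [Countable V] {G : SimpleGraph V} [G.LocallyFinite] (Φ : PlanarSkeletonFrmFrom G) (t : V) (p : unitInterval) (D : Skelφ.StepI.DataNS V) (g : ℕ) (f : ℕ) (b : Fin 2 → ℕ) (hN : EqNumL κ Φ t p D g f) :
    (prFA κ Φ t p D g f).D * ((prFA κ Φ t p D g f).c₁ * ((prFA κ Φ t p D g f).n : ℤ) * ((b 0 : ℤ) + 1) +
        (prFA κ Φ t p D g f).c₀ * |(prFA κ Φ t p D g f).vα| * ((b 1 : ℤ) + 1)) ≤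
      (prFA κ Φ t p D g f).c₀ * (prFA κ Φ t p D g f).c₁ * (prFA κ Φ t p D g f).A *
        modulus (prFA κ Φ t p D g f).n (prFA κ Φ t p D g f).h (prFA κ Φ t p D g f).vα (prFA κ Φ t p D g f).vβ * aWS κ Φ t p D g f b := by
  obtain ⟨hA, hA0, -, -, -, hm, -⟩ := prFA_ids κ Φ t p D g f hN
  obtain ⟨hc₀, hc₁⟩ := prFA_c_pos κ Φ t p D g f
  unfold aWS
  rw [hA]
  exact PlanarSkeletonNeg.NegB.ceil_mul_le (by positivity)

/-- **`hBx`**: `D·(b₁+1) ≤ c₁·A·BxS`. [folklore] -/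
theorem hBx_S (κ : Consts) {V : Type} [DecidableEq V] [Countable V] {G : SimpleGraph V} [G.LocallyFinite] (Φ : PlanarSkeletonFrmFrom G) (t : V) (p : unitInterval) (D : Skelφ.StepI.DataNS V) (g : ℕ) (f : ℕ) (b : Fin 2 → ℕ) (hN : EqNumL κ Φ t p D g f) :
    (prFA κ Φ t p D g f).D * ((b 1 : ℤ) + 1) ≤ (prFA κ Φ t p D g f).c₁ * (prFA κ Φ t p D g f).A * BxS κ Φ t p D g f b := by
  obtain ⟨hA, hA0, -⟩ := prFA_ids κ Φ t p D g f hN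
  obtain ⟨-, hc₁⟩ := prFA_c_pos κ Φ t p D g f
  unfold BxS
  rw [hA]
  exact PlanarSkeletonNeg.NegB.ceil_mul_le (by positivity)

/-- **`hb`**: `BxS / U + 1 ≤ bLS` (`rfl`). [folklore] -/
theorem hb_S (κ : Consts) {V : Type} [DecidableEq V] [Countable V] {G : SimpleGraph V} [G.LocallyFinite] (Φ : PlanarSkeletonFrmFrom G) (t : V) (p : unitInterval) (D : Skelφ.StepI.DataNS V) (g : ℕ) (f : ℕ) (b : Fin 2 → ℕ) : BxS κ Φ t p D g f b / (shearUnit (nL κ Φ t p D g f) (hL κ Φ t p D g f) : ℤ) + 1 ≤ bLS κ Φ t p D g f b := le_rfl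

/-- **THE ALONG HALF-WIDTH IS `O(n_L)` FOR A SMALL WINDOW**: `aWS b ≤ (e₀ + e₁ + 1)·n_L` whenever `b 0 + 1 ≤ e₀·s₀` and `|v_L|·(b 1 + 1) ≤ e₁·n_L·s₁`
(after cancelling `A³·m`: `aW − 1 = ⌊(s₁·n·(b₀+1) + s₀·|v|·(b₁+1))/(s₀·s₁)⌋ < (e₀ + e₁ + 1)·n`). [this work] -/
theorem aWS_le_of (κ : Consts) {V : Type} [DecidableEq V] [Countable V] {G : SimpleGraph V} [G.LocallyFinite] (Φ : PlanarSkeletonFrmFrom G) (t : V) (p : unitInterval) (D : Skelφ.StepI.DataNS V) (g : ℕ) (f : ℕ) (b : Fin 2 → ℕ) {e₀ e₁ : ℤ} (hN : EqNumL κ Φ t p D g f) (hb0 : (b 0 : ℤ) + 1 ≤ e₀ * (((fcellsA κ Φ t p D g f).s 0 : ℕ) : ℤ))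
    (hb1 : |vL κ Φ t p D g f| * ((b 1 : ℤ) + 1) ≤ e₁ * (nL κ Φ t p D g f : ℤ) * (((fcellsA κ Φ t p D g f).s 1 : ℕ) : ℤ)) :
    aWS κ Φ t p D g f b ≤ (e₀ + e₁ + 1) * (nL κ Φ t p D g f : ℤ) := by
  obtain ⟨hA, hA0, hD, hc₀, hc₁, hm, hn, hv⟩ := prFA_ids κ Φ t p D g f hN
  have hn1 : (1 : ℤ) ≤ ((prFA κ Φ t p D g f).n : ℤ) := by rw [hn]; exact_mod_cast (one_le_of_eqNumL κ Φ t p D g f hN).1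
  have hb1' : |(prFA κ Φ t p D g f).vα| * ((b 1 : ℤ) + 1) ≤ e₁ * ((prFA κ Φ t p D g f).n : ℤ) * (((fcellsA κ Φ t p D g f).s 1 : ℕ) : ℤ) := by
    rw [hv, hn]; exact hb1
  have hs0 : (1 : ℤ) ≤ (((fcellsA κ Φ t p D g f).s 0 : ℕ) : ℤ) := by exact_mod_cast (fcellsA κ Φ t p D g f).hs 0
  have hs1 : (1 : ℤ) ≤ (((fcellsA κ Φ t p D g f).s 1 : ℕ) : ℤ) := by exact_mod_cast (fcellsA κ Φ t p D g f).hs 1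
  have hgoal : (e₀ + e₁ + 1) * (nL κ Φ t p D g f : ℤ) = (e₀ + e₁ + 1) * ((prFA κ Φ t p D g f).n : ℤ) := by rw [hn]
  rw [hgoal]
  unfold aWS
  rw [hD, hc₀, hc₁, hA]
  set A := Aof κ with hAdef
  set m := modulus (prFA κ Φ t p D g f).n (prFA κ Φ t p D g f).h (prFA κ Φ t p D g f).vα (prFA κ Φ t p D g f).vβ with hmdef
  set s0 := (((fcellsA κ Φ t p D g f).s 0 : ℕ) : ℤ) with hs0def
  set s1 := (((fcellsA κ Φ t p D g f).s 1 : ℕ) : ℤ) with hs1def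
  set n := ((prFA κ Φ t p D g f).n : ℤ) with hndef
  set va := |(prFA κ Φ t p D g f).vα| with hvadef
  have hb00 : (0 : ℤ) ≤ (b 0 : ℤ) := by positivity
  have hb10 : (0 : ℤ) ≤ (b 1 : ℤ) := by positivity
  have hva : (0 : ℤ) ≤ va := abs_nonneg _
  -- X / Y + 1 ≤ (e₀+e₁+1) n  ⟸  X < (e₀+e₁+1) n · Y
  have hY : 0 < A * s0 * (A * s1) * A * m := by positivity
  have h1 : s1 * n * ((b 0 : ℤ) + 1) ≤ e₀ * (s0 * s1 * n) := by
    calc s1 * n * ((b 0 : ℤ) + 1) = (s1 * n) * ((b 0 : ℤ) + 1) := by ring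
      _ ≤ (s1 * n) * (e₀ * s0) := mul_le_mul_of_nonneg_left hb0 (by positivity)
      _ = e₀ * (s0 * s1 * n) := by ring
  have h2 : s0 * (va * ((b 1 : ℤ) + 1)) ≤ e₁ * (s0 * s1 * n) := by
    calc s0 * (va * ((b 1 : ℤ) + 1)) ≤ s0 * (e₁ * n * s1) := mul_le_mul_of_nonneg_left hb1' (by positivity)
      _ = e₁ * (s0 * s1 * n) := by ring
  have hssn : 1 ≤ s0 * s1 * n := by
    have := mul_le_mul hs0 hs1 (by norm_num) (by positivity)
    nlinarith
  have h3 : s1 * n * ((b 0 : ℤ) + 1) + s0 * (va * ((b 1 : ℤ) + 1)) < (e₀ + e₁ + 1) * (s0 * s1 * n) := by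
    have e : (e₀ + e₁ + 1) * (s0 * s1 * n) = e₀ * (s0 * s1 * n) + e₁ * (s0 * s1 * n) + s0 * s1 * n := by ring
    rw [e]; linarith
  have hkey : A * s1 * n * ((b 0 : ℤ) + 1) + A * s0 * va * ((b 1 : ℤ) + 1) < (e₀ + e₁ + 1) * n * (A * s0 * s1) := by
    calc A * s1 * n * ((b 0 : ℤ) + 1) + A * s0 * va * ((b 1 : ℤ) + 1) = A * (s1 * n * ((b 0 : ℤ) + 1) + s0 * (va * ((b 1 : ℤ) + 1))) := by ring
      _ < A * ((e₀ + e₁ + 1) * (s0 * s1 * n)) := mul_lt_mul_of_pos_left h3 hA0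
      _ = (e₀ + e₁ + 1) * n * (A * s0 * s1) := by ring
  have hA2m : 0 < A ^ 2 * m := by positivity
  have hX : A ^ 2 * m * (A * s1 * n * ((b 0 : ℤ) + 1) + A * s0 * va * ((b 1 : ℤ) + 1)) < (e₀ + e₁ + 1) * n * (A * s0 * (A * s1) * A * m) := by
    calc A ^ 2 * m * (A * s1 * n * ((b 0 : ℤ) + 1) + A * s0 * va * ((b 1 : ℤ) + 1))
        < A ^ 2 * m * ((e₀ + e₁ + 1) * n * (A * s0 * s1)) := mul_lt_mul_of_pos_left hkey hA2m
      _ = (e₀ + e₁ + 1) * n * (A * s0 * (A * s1) * A * m) := by ring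
  have := Int.ediv_lt_of_lt_mul hY hX
  linarith

/-- `aWS b ≤ 40·n_L` whenever `b 0 + 1 ≤ 19·s₀` and `|v_L|·(b 1 + 1) ≤ 19·n_L·s₁`. [this work] -/
theorem aWS_le (κ : Consts) {V : Type} [DecidableEq V] [Countable V] {G : SimpleGraph V} [G.LocallyFinite] (Φ : PlanarSkeletonFrmFrom G) (t : V) (p : unitInterval) (D : Skelφ.StepI.DataNS V) (g : ℕ) (f : ℕ) (b : Fin 2 → ℕ) (hN : EqNumL κ Φ t p D g f) (hb0 : (b 0 : ℤ) + 1 ≤ 19 * (((fcellsA κ Φ t p D g f).s 0 : ℕ) : ℤ))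
    (hb1 : |vL κ Φ t p D g f| * ((b 1 : ℤ) + 1) ≤ 19 * (nL κ Φ t p D g f : ℤ) * (((fcellsA κ Φ t p D g f).s 1 : ℕ) : ℤ)) :
    aWS κ Φ t p D g f b ≤ 40 * (nL κ Φ t p D g f : ℤ) := by
  have h := aWS_le_of κ Φ t p D g f b hN hb0 hb1
  have hn : (0 : ℤ) ≤ nL κ Φ t p D g f := by positivity
  linarith

/-- The small window meets the two smallness rows: `30s₀ + 1 ≤ 31·s₀`, `|v_L|·(8s₁ + 1) ≤ 9·n_L·s₁`. [folklore] -/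
theorem small_rows (κ : Consts) {V : Type} [DecidableEq V] [Countable V] {G : SimpleGraph V} [G.LocallyFinite] (Φ : PlanarSkeletonFrmFrom G) (t : V) (p : unitInterval) (D : Skelφ.StepI.DataNS V) (g : ℕ) (f : ℕ) (hN : EqNumL κ Φ t p D g f) :
    ((BSlot.small κ Φ t p D g f 0 : ℕ) : ℤ) + 1 ≤ 31 * (((fcellsA κ Φ t p D g f).s 0 : ℕ) : ℤ) ∧
    |vL κ Φ t p D g f| * (((BSlot.small κ Φ t p D g f 1 : ℕ) : ℤ) + 1) ≤ 9 * (nL κ Φ t p D g f : ℤ) * (((fcellsA κ Φ t p D g f).s 1 : ℕ) : ℤ) := by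
  have hs0 := (fcellsA κ Φ t p D g f).hs 0
  have hs1 : (1 : ℤ) ≤ (((fcellsA κ Φ t p D g f).s 1 : ℕ) : ℤ) := by exact_mod_cast (fcellsA κ Φ t p D g f).hs 1
  have hv := hN.v_le
  have hva : (0 : ℤ) ≤ |vL κ Φ t p D g f| := abs_nonneg _
  rw [(small_eq κ Φ t p D g f).1, (small_eq κ Φ t p D g f).2]
  push_cast
  constructor
  · have : (1 : ℤ) ≤ (((fcellsA κ Φ t p D g f).s 0 : ℕ) : ℤ) := by exact_mod_cast hs0
    linarith
  · nlinarith

/-- **`aWS small ≤ 41·n_L`.** [this work] -/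
theorem aWS_small_le (κ : Consts) {V : Type} [DecidableEq V] [Countable V] {G : SimpleGraph V} [G.LocallyFinite] (Φ : PlanarSkeletonFrmFrom G) (t : V) (p : unitInterval) (D : Skelφ.StepI.DataNS V) (g : ℕ) (f : ℕ) (hN : EqNumL κ Φ t p D g f) : aWS κ Φ t p D g f (BSlot.small κ Φ t p D g f) ≤ 41 * (nL κ Φ t p D g f : ℤ) := by
  obtain ⟨h0, h1⟩ := small_rows κ Φ t p D g f hN
  have h := aWS_le_of κ Φ t p D g f _ hN h0 h1
  norm_num at h; linarith

/-- **`BxS` after cancelling `A²`**: `BxS b = ⌊m·(b₁+1)/s₁⌋ + 1`. [folklore] -/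
theorem BxS_eq (κ : Consts) {V : Type} [DecidableEq V] [Countable V] {G : SimpleGraph V} [G.LocallyFinite] (Φ : PlanarSkeletonFrmFrom G) (t : V) (p : unitInterval) (D : Skelφ.StepI.DataNS V) (g : ℕ) (f : ℕ) (b : Fin 2 → ℕ) (hN : EqNumL κ Φ t p D g f) :
    BxS κ Φ t p D g f b = modulus (prFA κ Φ t p D g f).n (prFA κ Φ t p D g f).h (prFA κ Φ t p D g f).vα (prFA κ Φ t p D g f).vβ * ((b 1 : ℤ) + 1) /
      (((fcellsA κ Φ t p D g f).s 1 : ℕ) : ℤ) + 1 := by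
  obtain ⟨hA, hA0, hD, -, hc₁, -, -, -⟩ := prFA_ids κ Φ t p D g f hN
  unfold BxS
  rw [hD, hc₁, hA]
  have e1 : Aof κ ^ 2 * modulus (prFA κ Φ t p D g f).n (prFA κ Φ t p D g f).h (prFA κ Φ t p D g f).vα (prFA κ Φ t p D g f).vβ * ((b 1 : ℤ) + 1) =
      (Aof κ * Aof κ) * (modulus (prFA κ Φ t p D g f).n (prFA κ Φ t p D g f).h (prFA κ Φ t p D g f).vα (prFA κ Φ t p D g f).vβ * ((b 1 : ℤ) + 1)) := by ring
  have e2 : Aof κ * (((fcellsA κ Φ t p D g f).s 1 : ℕ) : ℤ) * Aof κ = (Aof κ * Aof κ) * (((fcellsA κ Φ t p D g f).s 1 : ℕ) : ℤ) := by ring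
  rw [e1, e2, Int.mul_ediv_mul_of_pos _ _ (by positivity)]

/-- **THE ACROSS HALF-WIDTH IS `O(sL)` FOR A SMALL WINDOW**: `bLS b ≤ e·sL + 2e + 2` whenever `b 1 + 1 ≤ e·s₁` (`m ≤ n_Lℓ_L < (sL+2)·U`). [this work] -/
theorem bLS_le (κ : Consts) {V : Type} [DecidableEq V] [Countable V] {G : SimpleGraph V} [G.LocallyFinite] (Φ : PlanarSkeletonFrmFrom G) (t : V) (p : unitInterval) (D : Skelφ.StepI.DataNS V) (g : ℕ) (f : ℕ) (b : Fin 2 → ℕ) {e : ℤ} (he : 0 ≤ e) (hN : EqNumL κ Φ t p D g f) (hb1 : (b 1 : ℤ) + 1 ≤ e * (((fcellsA κ Φ t p D g f).s 1 : ℕ) : ℤ)) :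
    bLS κ Φ t p D g f b ≤ e * kgSL (nL κ Φ t p D g f) (ℓL κ Φ t p D g f) (hL κ Φ t p D g f) + 2 * e + 2 := by
  obtain ⟨-, -, -, -, -, hm, hn, hv⟩ := prFA_ids κ Φ t p D g f hN
  obtain ⟨hn1, hℓ1⟩ := one_le_of_eqNumL κ Φ t p D g f hN
  have hs1 : (0 : ℤ) < (((fcellsA κ Φ t p D g f).s 1 : ℕ) : ℤ) := by exact_mod_cast (fcellsA κ Φ t p D g f).hs 1
  have hU : (0 : ℤ) < (shearUnit (nL κ Φ t p D g f) (hL κ Φ t p D g f) : ℕ) := Skelφ.shearUnit_pos hn1 _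
  have hBx := BxS_eq κ Φ t p D g f b hN
  set m := modulus (prFA κ Φ t p D g f).n (prFA κ Φ t p D g f).h (prFA κ Φ t p D g f).vα (prFA κ Φ t p D g f).vβ with hmdef
  set s1 := (((fcellsA κ Φ t p D g f).s 1 : ℕ) : ℤ) with hs1def
  set U := ((shearUnit (nL κ Φ t p D g f) (hL κ Φ t p D g f) : ℕ) : ℤ) with hUdef
  -- m ≤ nℓ and nℓ < (sL + 2)·U
  have hmle : m ≤ (nL κ Φ t p D g f : ℤ) * ℓL κ Φ t p D g f := by
    have := (Skelφ.NegPrm.modulus_vβOf hn1 (hL κ Φ t p D g f) (ℓL κ Φ t p D g f) (vL κ Φ t p D g f)).2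
    rw [hmdef, hn, hv]; exact this
  have hlt := Int.lt_ediv_add_one_mul_self ((nL κ Φ t p D g f : ℤ) * ℓL κ Φ t p D g f - U + 1) hU
  have hsLe : ((nL κ Φ t p D g f : ℤ) * ℓL κ Φ t p D g f - U + 1) / U = kgSL (nL κ Φ t p D g f) (ℓL κ Φ t p D g f) (hL κ Φ t p D g f) := rfl
  rw [hsLe] at hlt
  set sL := kgSL (nL κ Φ t p D g f) (ℓL κ Φ t p D g f) (hL κ Φ t p D g f) with hsLdef
  -- BxS ≤ e·m + 1
  have h1 : m * ((b 1 : ℤ) + 1) / s1 ≤ e * m := by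
    have : m * ((b 1 : ℤ) + 1) ≤ (e * m) * s1 := by nlinarith
    calc m * ((b 1 : ℤ) + 1) / s1 ≤ (e * m) * s1 / s1 := Int.ediv_le_ediv hs1 this
      _ = e * m := Int.mul_ediv_cancel _ (ne_of_gt hs1)
  have hBx' : BxS κ Φ t p D g f b ≤ e * m + 1 := by rw [hBx]; linarith
  -- bLS = BxS/U + 1 ≤ (e nℓ + U)/U + 1 = e·nℓ/U + 2 ≤ e sL + 2e + 2
  have h2 : BxS κ Φ t p D g f b / U ≤ (e * ((nL κ Φ t p D g f : ℤ) * ℓL κ Φ t p D g f) + 1 * U) / U :=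
    Int.ediv_le_ediv hU (by nlinarith)
  rw [Int.add_mul_ediv_right _ _ (ne_of_gt hU)] at h2
  have h3 : e * ((nL κ Φ t p D g f : ℤ) * ℓL κ Φ t p D g f) / U < e * sL + 2 * e + 1 := by
    apply Int.ediv_lt_of_lt_mul hU
    have : e * ((nL κ Φ t p D g f : ℤ) * ℓL κ Φ t p D g f) ≤ e * ((sL + 2) * U - 1) := mul_le_mul_of_nonneg_left (by linarith) he
    nlinarith
  unfold bLS
  linarith

/-- The small window meets the across smallness row: `8s₁ + 1 ≤ 9·s₁`. [folklore] -/
theorem small_row_across (κ : Consts) {V : Type} [DecidableEq V] [Countable V] {G : SimpleGraph V} [G.LocallyFinite] (Φ : PlanarSkeletonFrmFrom G) (t : V) (p : unitInterval) (D : Skelφ.StepI.DataNS V) (g : ℕ) (f : ℕ) : ((BSlot.small κ Φ t p D g f 1 : ℕ) : ℤ) + 1 ≤ 9 * (((fcellsA κ Φ t p D g f).s 1 : ℕ) : ℤ) := by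
  have hs1 : (1 : ℤ) ≤ (((fcellsA κ Φ t p D g f).s 1 : ℕ) : ℤ) := by exact_mod_cast (fcellsA κ Φ t p D g f).hs 1
  rw [(small_eq κ Φ t p D g f).2]; push_cast; linarith

end StartBox

/-! ## §3 The residual values of record and the start-box row `haq` -/

section Residuals

variable (κ : Consts) {V : Type} [DecidableEq V] [Countable V] {G : SimpleGraph V} [G.LocallyFinite] (Φ : PlanarSkeletonFrmFrom G) (t : V) (p : unitInterval)
  (D : Skelφ.StepI.DataNS V) (g f : ℕ)

/-- **The along residual of record** `qxQ := 39·n_L` (so `kgq qxQ = 41·n_L ≥ aWS small`; kept minimal — `q` enters the prism's back reach `Z₀` twice). [this work] -/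
def qxQ (κ : Consts) {V : Type} [DecidableEq V] [Countable V] {G : SimpleGraph V} [G.LocallyFinite] (Φ : PlanarSkeletonFrmFrom G) (t : V) (p : unitInterval) (D : Skelφ.StepI.DataNS V) (g : ℕ) (f : ℕ) : ℕ := 39 * nL κ Φ t p D g f

/-- **The across residual of record** `WxQ := (8·sL).toNat + 19` (so `P + kgW WxQ ≥ 9·sL + 20 ≥ bLS small`; kept minimal — `W` drives `m₁`). [this work] -/
def WxQ (κ : Consts) {V : Type} [DecidableEq V] [Countable V] {G : SimpleGraph V} [G.LocallyFinite] (Φ : PlanarSkeletonFrmFrom G) (t : V) (p : unitInterval) (D : Skelφ.StepI.DataNS V) (g : ℕ) (f : ℕ) : ℕ := (8 * kgSL (nL κ Φ t p D g f) (ℓL κ Φ t p D g f) (hL κ Φ t p D g f)).toNat + 19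

/-- **The residual floors hold at the values of record** (`KGRes … qxQ WxQ`, SkelFrmBParamsCorrKGLen), under `EqNumL` (for `0 ≤ sL`). [this work] -/
theorem kgRes_Q (κ : Consts) {V : Type} [DecidableEq V] [Countable V] {G : SimpleGraph V} [G.LocallyFinite] (Φ : PlanarSkeletonFrmFrom G) (t : V) (p : unitInterval) (D : Skelφ.StepI.DataNS V) (g : ℕ) (f : ℕ) (hN : EqNumL κ Φ t p D g f) : KGRes κ Φ t p D g f (qxQ κ Φ t p D g f) (WxQ κ Φ t p D g f) := by
  refine ⟨by unfold qxQ; omega, ?_⟩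
  have hsL := ML_sub_one_le_kgSL κ Φ t p D g f hN
  have h960 := slack_floor_le_ML κ Φ t p D g
  have hM : (959 : ℤ) ≤ ML κ Φ t p D g := by exact_mod_cast (show 959 ≤ ML κ Φ t p D g by omega)
  unfold WxQ
  push_cast
  rw [Int.toNat_of_nonneg (by linarith)]
  linarith

/-- **`haq`**: `aWS b ≤ kgq qxQ` for every window meeting the two smallness rows with `(e₀, e₁) = (31, 9)` (in particular `small`). [this work] -/
theorem haq_S (κ : Consts) {V : Type} [DecidableEq V] [Countable V] {G : SimpleGraph V} [G.LocallyFinite] (Φ : PlanarSkeletonFrmFrom G) (t : V) (p : unitInterval) (D : Skelφ.StepI.DataNS V) (g : ℕ) (f : ℕ) (b : Fin 2 → ℕ) (hN : EqNumL κ Φ t p D g f) (hb0 : (b 0 : ℤ) + 1 ≤ 31 * (((fcellsA κ Φ t p D g f).s 0 : ℕ) : ℤ))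
    (hb1 : |vL κ Φ t p D g f| * ((b 1 : ℤ) + 1) ≤ 9 * (nL κ Φ t p D g f : ℤ) * (((fcellsA κ Φ t p D g f).s 1 : ℕ) : ℤ)) :
    aWS κ Φ t p D g f b ≤ ((kgq κ Φ t p D g f (qxQ κ Φ t p D g f) : ℕ) : ℤ) := by
  have h := aWS_le_of κ Φ t p D g f b hN hb0 hb1
  norm_num at h
  unfold kgq qxQ; push_cast; linarith

/-- **`haq` at the window of record.** [this work] -/
theorem haq_small (κ : Consts) {V : Type} [DecidableEq V] [Countable V] {G : SimpleGraph V} [G.LocallyFinite] (Φ : PlanarSkeletonFrmFrom G) (t : V) (p : unitInterval) (D : Skelφ.StepI.DataNS V) (g : ℕ) (f : ℕ) (hN : EqNumL κ Φ t p D g f) :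
    aWS κ Φ t p D g f (BSlot.small κ Φ t p D g f) ≤ ((kgq κ Φ t p D g f (qxQ κ Φ t p D g f) : ℕ) : ℤ) := by
  have h := aWS_small_le κ Φ t p D g f hN; unfold kgq qxQ; push_cast; linarith

/-! ### Second axis: the start-box rows `haWm/haWp/hbq` at `(qxYQ, WxYQ) := ((9·sL).toNat + 19, 39·n_L)` -/

/-- **The second-axis residuals of record**: `qxYQ := (9·sL).toNat + 19` (rows; `kgqY qxYQ = P + 9sL + 19 ≥ bLS small`), `WxYQ := 39·n_L` (x′ units;
`(n ± v)⁺ + kgWY WxYQ ≥ 41·n_L ≥ aWS small`). [this work] -/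
def qxYQ (κ : Consts) {V : Type} [DecidableEq V] [Countable V] {G : SimpleGraph V} [G.LocallyFinite] (Φ : PlanarSkeletonFrmFrom G) (t : V) (p : unitInterval) (D : Skelφ.StepI.DataNS V) (g : ℕ) (f : ℕ) : ℕ := (9 * kgSL (nL κ Φ t p D g f) (ℓL κ Φ t p D g f) (hL κ Φ t p D g f)).toNat + 19

/-- see `qxYQ`. [this work] -/
def WxYQ (κ : Consts) {V : Type} [DecidableEq V] [Countable V] {G : SimpleGraph V} [G.LocallyFinite] (Φ : PlanarSkeletonFrmFrom G) (t : V) (p : unitInterval) (D : Skelφ.StepI.DataNS V) (g : ℕ) (f : ℕ) : ℕ := 39 * nL κ Φ t p D g f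

/-- **`KGResY … qxYQ WxYQ`** (SkelFrmBParamsCorrKGLenY). [this work] -/
theorem kgResY_Q (κ : Consts) {V : Type} [DecidableEq V] [Countable V] {G : SimpleGraph V} [G.LocallyFinite] (Φ : PlanarSkeletonFrmFrom G) (t : V) (p : unitInterval) (D : Skelφ.StepI.DataNS V) (g : ℕ) (f : ℕ) (hN : EqNumL κ Φ t p D g f) : KGResY κ Φ t p D g f (qxYQ κ Φ t p D g f) (WxYQ κ Φ t p D g f) := by
  refine ⟨?_, by unfold WxYQ; omega⟩
  have hsL := ML_sub_one_le_kgSL κ Φ t p D g f hN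
  have h960 := slack_floor_le_ML κ Φ t p D g
  have hM : (959 : ℤ) ≤ ML κ Φ t p D g := by exact_mod_cast (show 959 ≤ ML κ Φ t p D g by omega)
  unfold qxYQ
  rw [kgSLY_eq_kgSL]
  push_cast
  rw [Int.toNat_of_nonneg (by linarith)]
  linarith

/-- **`haWm/haWp`** at the window of record: `aWS small ≤ (n_L ± v_L)⁺ + kgWY WxYQ` (`41·n_L ≤ 0 + 2n_L + 39n_L`). [this work] -/
theorem haW_small (κ : Consts) {V : Type} [DecidableEq V] [Countable V] {G : SimpleGraph V} [G.LocallyFinite] (Φ : PlanarSkeletonFrmFrom G) (t : V) (p : unitInterval) (D : Skelφ.StepI.DataNS V) (g : ℕ) (f : ℕ) (hN : EqNumL κ Φ t p D g f) :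
    aWS κ Φ t p D g f (BSlot.small κ Φ t p D g f) ≤ ((((nL κ Φ t p D g f : ℤ) + vL κ Φ t p D g f).toNat + kgWY κ Φ t p D g f (WxYQ κ Φ t p D g f) : ℕ) : ℤ) ∧
    aWS κ Φ t p D g f (BSlot.small κ Φ t p D g f) ≤ ((((nL κ Φ t p D g f : ℤ) - vL κ Φ t p D g f).toNat + kgWY κ Φ t p D g f (WxYQ κ Φ t p D g f) : ℕ) : ℤ) := by
  have h := aWS_small_le κ Φ t p D g f hN
  have h1 : (0 : ℤ) ≤ ((((nL κ Φ t p D g f : ℤ) + vL κ Φ t p D g f).toNat : ℕ) : ℤ) := by positivity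
  have h2 : (0 : ℤ) ≤ ((((nL κ Φ t p D g f : ℤ) - vL κ Φ t p D g f).toNat : ℕ) : ℤ) := by positivity
  unfold kgWY WxYQ
  constructor <;> · push_cast; linarith

/-- **`hbq`** at the window of record: `bLS small ≤ kgqY qxYQ = P + 9·sL + 19`. [this work] -/
theorem hbq_small (κ : Consts) {V : Type} [DecidableEq V] [Countable V] {G : SimpleGraph V} [G.LocallyFinite] (Φ : PlanarSkeletonFrmFrom G) (t : V) (p : unitInterval) (D : Skelφ.StepI.DataNS V) (g : ℕ) (f : ℕ) (hN : EqNumL κ Φ t p D g f) :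
    bLS κ Φ t p D g f (BSlot.small κ Φ t p D g f) ≤ ((kgqY κ Φ t p D g f (qxYQ κ Φ t p D g f) : ℕ) : ℤ) := by
  have h := bLS_le κ Φ t p D g f _ (by norm_num) hN (small_row_across κ Φ t p D g f)
  have hsL := ML_sub_one_le_kgSL κ Φ t p D g f hN
  have h960 := slack_floor_le_ML κ Φ t p D g
  have hM : (959 : ℤ) ≤ ML κ Φ t p D g := by exact_mod_cast (show 959 ≤ ML κ Φ t p D g by omega)
  unfold kgqY qxYQ
  push_cast
  rw [Int.toNat_of_nonneg (by linarith)]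
  have : (0 : ℤ) ≤ ((nL κ Φ t p D g f * ℓL κ Φ t p D g f / shearUnit (nL κ Φ t p D g f) (hL κ Φ t p D g f) : ℕ) : ℤ) := by positivity
  have : (0 : ℤ) ≤ (nL κ Φ t p D g f : ℤ) * (ℓL κ Φ t p D g f : ℤ) / ((shearUnit (nL κ Φ t p D g f) (hL κ Φ t p D g f) : ℕ) : ℤ) :=
    Int.ediv_nonneg (by positivity) (by positivity)
  linarith

/-- **`hbW`**: `bLS b ≤ P + kgW WxQ` for every window with `b 1 + 1 ≤ 9·s₁` (in particular `small`): `9sL + 20 ≤ P + sL + 8sL + 19`. [this work] -/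
theorem hbW_S (κ : Consts) {V : Type} [DecidableEq V] [Countable V] {G : SimpleGraph V} [G.LocallyFinite] (Φ : PlanarSkeletonFrmFrom G) (t : V) (p : unitInterval) (D : Skelφ.StepI.DataNS V) (g : ℕ) (f : ℕ) (b : Fin 2 → ℕ) (hN : EqNumL κ Φ t p D g f) (hb1 : (b 1 : ℤ) + 1 ≤ 9 * (((fcellsA κ Φ t p D g f).s 1 : ℕ) : ℤ)) :
    bLS κ Φ t p D g f b ≤ ((nL κ Φ t p D g f * ℓL κ Φ t p D g f / shearUnit (nL κ Φ t p D g f) (hL κ Φ t p D g f) + 1 +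
      kgW κ Φ t p D g f (WxQ κ Φ t p D g f) : ℕ) : ℤ) := by
  have h := bLS_le κ Φ t p D g f b (by norm_num) hN hb1
  have hsL := ML_sub_one_le_kgSL κ Φ t p D g f hN
  have h960 := slack_floor_le_ML κ Φ t p D g
  have hM : (959 : ℤ) ≤ ML κ Φ t p D g := by
    have : 959 ≤ ML κ Φ t p D g := by omega
    exact_mod_cast this
  have hs0 : 0 ≤ kgSL (nL κ Φ t p D g f) (ℓL κ Φ t p D g f) (hL κ Φ t p D g f) := by linarith
  unfold kgW WxQ
  push_cast
  rw [Int.toNat_of_nonneg hs0, Int.toNat_of_nonneg (by linarith)]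
  have : (0 : ℤ) ≤ (nL κ Φ t p D g f : ℤ) * (ℓL κ Φ t p D g f : ℤ) / ((shearUnit (nL κ Φ t p D g f) (hL κ Φ t p D g f) : ℕ) : ℤ) :=
    Int.ediv_nonneg (by positivity) (by positivity)
  linarith

/-- **`hbW` at the window of record.** [this work] -/
theorem hbW_small (κ : Consts) {V : Type} [DecidableEq V] [Countable V] {G : SimpleGraph V} [G.LocallyFinite] (Φ : PlanarSkeletonFrmFrom G) (t : V) (p : unitInterval) (D : Skelφ.StepI.DataNS V) (g : ℕ) (f : ℕ) (hN : EqNumL κ Φ t p D g f) :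
    bLS κ Φ t p D g f (BSlot.small κ Φ t p D g f) ≤ ((nL κ Φ t p D g f * ℓL κ Φ t p D g f / shearUnit (nL κ Φ t p D g f) (hL κ Φ t p D g f) + 1 +
      kgW κ Φ t p D g f (WxQ κ Φ t p D g f) : ℕ) : ℤ) :=
  hbW_S κ Φ t p D g f _ hN (small_row_across κ Φ t p D g f)

end Residuals

end NegB

end PlanarSkeletonFrmFrom

end Summit.CriticalPhenomena.PercolationContinuityZ3.Theorems.Transplant

end
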